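import Summits.KontsevichZagierPeriods.KontsevichZagierPeriods.Theorems.MzvKernelInKZTwoPosetsHoffmanDepthOneForest
import Summits.KontsevichZagierPeriods.KontsevichZagierPeriods.Theorems.MzvKernelInKZ.Negative.WeightFour

/-!
# `MzvKernelInKZ` (stmt-KontsevichZagierPeriods-3914), line two-posets-interior-landen: Hoffman's relation in depth one

The stub `stub_hoffmanDepthOne : CubicalChart → InteriorLanden → HoffmanDepthOneInKZ` of the crux
`LinRedNormalForm.MzvKernelInKZ`: for `k ≥ 3`, `[ζ(k+1)] − Σ_{j<k-1} [ζ(k−j, j+1)] ∈ KZ.relations`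
(Euler's depth-two sum formula, Hoffman's relation in depth one) by a chain of moves with absolutely
convergent rational intermediates.  With `k = m + 1`:

* (P)+(D) the order polytope `P` of the chain-plus-one poset and its dissection
  `[P] ≡ Σ_{j<m} [ζ(m+1−j, j+1)] + [ζ(m+1, 1)]` (`stub_hoffmanDepthOnePolytope`);
* (F) the forest chart: `[P] ≡ [□, v/((1−yv)(1−vr))]` (`stub_hoffmanDepthOneForest`);
* (E′) the interior Landen identity (hypothesis `InteriorLanden`):
  `[□, v/((1−yv)(1−vr))] ≡ [□, 1/((1−yv)(1−yvr))]`;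
* (PF) one positive partial fraction (rule 1b):
  `1/((1−Y)(1−Yr)) = Y/((1−Y)(1−Yr)) + 1/(1−Yr)`, `Y = yv = T_{m+1}`, `Yr = T_{m+2}`;
* (CC) the two summands ARE the cubical pull-backs of `ω_{0^m11}` and `ω_{0^{m+1}1}` (the tree's block
  identity), so by the hypothesis `CubicalChart` they are `≡ [ζ(m+1,1)]` and `≡ [ζ(m+2)]`.

Subtracting the two expressions of `[P]` gives the relation.  The `k = 3` instance is the refuters'
weight-4 element `Negative.cHoffman4` (`cHoffman4_mem_relations_of`).

References: M. E. Hoffman, *Multiple harmonic series*, Pacific J. Math. 152 (1992), Thm 5.1;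
M. Kontsevich, D. Zagier, *Periods* (2001), §1.2; M. Kaneko, S. Yamamoto, Selecta Math. 24 (2018).
-/

noncomputable section

namespace Summit.KontsevichZagierPeriods.MzvKernelInKZ.TwoPosets

open Set MeasureTheory
open Literature.NumberTheory.Transcendental
open Summit.KontsevichZagierPeriods.MzvKernelInKZ.Negative

namespace HoffmanDepthOne

/-! ## The right Landen side: two cubical charts and one partial fraction -/

section Landen

open MvPolynomial
open Summit.KontsevichZagierPeriods.FurushoPentagon.HoffmanRelationInKZ
  (partialProd_zero partialProd_succ)

variable {m : ℕ} {T : ℕ → (Fin (m + 2) → ℝ) → ℝ}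
  (hT : ∀ k x, T k x = ∏ j : Fin (m + 2), if (j : ℕ) < k then x j else 1)

/-- The index `(m+1, 1)` is admissible for `m ≥ 1`. [cite: Zagier1994, §1] -/
theorem isAdmissible_chain_one (hm : 1 ≤ m) : MZV.IsAdmissible [m + 1, 1] :=
  ⟨fun i hi => by simp at hi; omega, fun _ => by show 2 ≤ m + 1; omega⟩

/-- The index `(m+2)` is admissible. [cite: Zagier1994, §1] -/
theorem isAdmissible_top (m : ℕ) : MZV.IsAdmissible [m + 2] :=
  ⟨fun i hi => by simp at hi; omega, fun _ => by show 2 ≤ m + 2; omega⟩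

include hT

/-- On the open cube `1 − T_{k+1}(x) ≠ 0`. [folklore] -/
theorem one_sub_T_ne_zero {x : Fin (m + 2) → ℝ} (hx : x ∈ cube (m + 2)) (k : ℕ) :
    1 - T (k + 1) x ≠ 0 :=
  (sub_pos.2 (T_succ_lt_one hT hx (Nat.succ_pos _) k)).ne'

/-- **Cubical chart of `ζ(m+1, 1)`**: on the open cube
`cubicalFun ω_{0^m11} 1 = Y/((1 − Y)(1 − Y r))`, `Y = T_{m+1}`, `Y r = T_{m+2}`.
[cite: KontsevichZagier2001, §1.2 rule (2)] -/
theorem cubicalFun_chain_one {x : Fin (m + 2) → ℝ} (hx : x ∈ cube (m + 2)) :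
    cubicalFun (bword (m + 2) [m + 1, 1]) 1 x =
      T (m + 1) x / ((1 - T (m + 1) x) * (1 - T (m + 2) x)) := by
  rw [cubicalFun_one_eq hT [m + 1, 1] (fun a ha => by simp at ha; omega) rfl x
    fun i => (hx i).1.ne']
  show ∏ l : Fin 2, T (([m + 1, 1] : List ℕ).take l).sum x /
    (1 - T (([m + 1, 1] : List ℕ).take ((l : ℕ) + 1)).sum x) = _
  rw [Fin.prod_univ_two]
  simp only [Fin.isValue, Fin.val_zero, Fin.val_one, List.take_zero, List.sum_nil,
    List.take_succ_cons, List.take_nil, List.sum_cons, add_zero, partialProd_zero T hT,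
    show m + 1 + 1 = m + 2 from rfl]
  rw [div_mul_div_comm, one_mul]

/-- **Cubical chart of `ζ(m+2)`**: on the open cube `cubicalFun ω_{0^{m+1}1} 1 = 1/(1 − T_{m+2})`.
[cite: KontsevichZagier2001, §1.2 rule (2)] -/
theorem cubicalFun_top {x : Fin (m + 2) → ℝ} (hx : x ∈ cube (m + 2)) :
    cubicalFun (bword (m + 2) [m + 2]) 1 x = 1 / (1 - T (m + 2) x) := by
  rw [cubicalFun_one_eq hT [m + 2] (by simp) rfl x fun i => (hx i).1.ne']
  simp only [Finset.univ_unique, Fin.default_eq_zero, Fin.isValue, Finset.prod_singleton,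
    Fin.val_zero, List.take_zero, List.sum_nil, List.take_succ_cons, List.take_nil, List.sum_cons,
    add_zero, List.length_singleton, partialProd_zero T hT]

/-- The right Landen integrand in partial products: `1/((1 − yv)(1 − yvr)) = 1/((1 − T_{m+1})(1 − T_{m+2}))`.
[cite: KanekoYamamoto2018, Thm 4.1] -/
theorem landenRight_eq (x : Fin (m + 2) → ℝ) :
    1 / ((1 - T (m + 1) x) * (1 - T (m + 2) x)) = landenRight m x := by
  rw [landenRight, T_chain hT, T_all hT]

/-- **The partial fraction** `1/((1 − Y)(1 − Yr)) = Y/((1 − Y)(1 − Yr)) + 1/(1 − Yr)` on the open cube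
(both summands positive). [folklore] -/
theorem landenRight_split {x : Fin (m + 2) → ℝ} (hx : x ∈ cube (m + 2)) :
    1 / ((1 - T (m + 1) x) * (1 - T (m + 2) x)) =
      T (m + 1) x / ((1 - T (m + 1) x) * (1 - T (m + 2) x)) + 1 / (1 - T (m + 2) x) := by
  have h1 := one_sub_T_ne_zero hT hx m
  have h2 := one_sub_T_ne_zero hT hx (m + 1)
  field_simp
  ring

/-- The partial products are `ℚ`-polynomials: `T_k(x) = aeval x (∏_{j<k} X_j)`. [folklore] -/
theorem aeval_prod_ite (x : Fin (m + 2) → ℝ) (k : ℕ) :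
    aeval x (∏ j : Fin (m + 2), (if (j : ℕ) < k then X j else 1 : MvPolynomial (Fin (m + 2)) ℚ)) =
      T k x := by
  rw [hT, map_prod]
  refine Finset.prod_congr rfl fun j _ => ?_
  split_ifs <;> simp

/-- `Y/((1 − Y)(1 − Yr))` is a quotient of `ℚ`-polynomials with non-vanishing denominator on the cube,
hence `ℚ`-semialgebraic there. [cite: KontsevichZagier2001, §1.1] -/
theorem isSemialgebraicFunOn_split₁ :
    IsSemialgebraicFunOn ℚ (cube (m + 2))
      fun x => T (m + 1) x / ((1 - T (m + 1) x) * (1 - T (m + 2) x)) := by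
  refine (isSemialgebraicFunOn_aeval_div_aeval (isSemialgebraic_cube (m + 2))
    (∏ j : Fin (m + 2), (if (j : ℕ) < m + 1 then X j else 1 : MvPolynomial (Fin (m + 2)) ℚ))
    ((1 - ∏ j : Fin (m + 2), (if (j : ℕ) < m + 1 then X j else 1 : MvPolynomial (Fin (m + 2)) ℚ)) *
      (1 - ∏ j : Fin (m + 2), (if (j : ℕ) < m + 2 then X j else 1 : MvPolynomial (Fin (m + 2)) ℚ)))
    fun x hx => ?_).congr fun x _ => ?_
  · rw [map_mul, map_sub, map_sub, map_one, aeval_prod_ite hT, aeval_prod_ite hT]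
    exact mul_ne_zero (one_sub_T_ne_zero hT hx m) (one_sub_T_ne_zero hT hx (m + 1))
  · simp only [map_mul, map_sub, map_one, aeval_prod_ite hT]

/-- `1/(1 − Yr)` is `ℚ`-semialgebraic on the cube. [cite: KontsevichZagier2001, §1.1] -/
theorem isSemialgebraicFunOn_split₂ :
    IsSemialgebraicFunOn ℚ (cube (m + 2)) fun x => 1 / (1 - T (m + 2) x) := by
  refine (isSemialgebraicFunOn_aeval_div_aeval (isSemialgebraic_cube (m + 2)) 1
    (1 - ∏ j : Fin (m + 2), (if (j : ℕ) < m + 2 then X j else 1 : MvPolynomial (Fin (m + 2)) ℚ))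
    fun x hx => ?_).congr fun x _ => ?_
  · rw [map_sub, map_one, aeval_prod_ite hT]
    exact one_sub_T_ne_zero hT hx (m + 1)
  · simp only [map_sub, map_one, aeval_prod_ite hT]

/-- `1/((1 − Y)(1 − Yr))` is `ℚ`-semialgebraic on the cube. [cite: KontsevichZagier2001, §1.1] -/
theorem isSemialgebraicFunOn_landenRight :
    IsSemialgebraicFunOn ℚ (cube (m + 2)) fun x => 1 / ((1 - T (m + 1) x) * (1 - T (m + 2) x)) := by
  refine (isSemialgebraicFunOn_aeval_div_aeval (isSemialgebraic_cube (m + 2)) 1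
    ((1 - ∏ j : Fin (m + 2), (if (j : ℕ) < m + 1 then X j else 1 : MvPolynomial (Fin (m + 2)) ℚ)) *
      (1 - ∏ j : Fin (m + 2), (if (j : ℕ) < m + 2 then X j else 1 : MvPolynomial (Fin (m + 2)) ℚ)))
    fun x hx => ?_).congr fun x _ => ?_
  · rw [map_mul, map_sub, map_sub, map_one, aeval_prod_ite hT, aeval_prod_ite hT]
    exact mul_ne_zero (one_sub_T_ne_zero hT hx m) (one_sub_T_ne_zero hT hx (m + 1))
  · simp only [map_mul, map_sub, map_one, aeval_prod_ite hT]

/-- Absolute integrability of `Y/((1 − Y)(1 − Yr))` on the cube: it IS the cubical pull-back of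
`ω_{0^m11}` there (hypothesis `CubicalChart`). [folklore] -/
theorem integrableOn_split₁ (hC : CubicalChart) (hm : 1 ≤ m) :
    IntegrableOn (fun x => T (m + 1) x / ((1 - T (m + 1) x) * (1 - T (m + 2) x))) (cube (m + 2))
      volume :=
  ((hC (m + 2) _ (adm_bword (isAdmissible_chain_one hm) rfl) 1).1).congr_fun
    (fun _ hx => cubicalFun_chain_one hT hx) (isOpen_openUnitCube (d := m + 2)).measurableSet

/-- Absolute integrability of `1/(1 − Yr)` on the cube (the cubical pull-back of `ω_{0^{m+1}1}`).
[folklore] -/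
theorem integrableOn_split₂ (hC : CubicalChart) :
    IntegrableOn (fun x => 1 / (1 - T (m + 2) x)) (cube (m + 2)) volume :=
  ((hC (m + 2) _ (adm_bword (isAdmissible_top m) rfl) 1).1).congr_fun
    (fun _ hx => cubicalFun_top hT hx) (isOpen_openUnitCube (d := m + 2)).measurableSet

/-- Absolute integrability of the right Landen integrand on the cube (sum of the two). [folklore] -/
theorem integrableOn_landenRight (hC : CubicalChart) (hm : 1 ≤ m) :
    IntegrableOn (fun x => 1 / ((1 - T (m + 1) x) * (1 - T (m + 2) x))) (cube (m + 2)) volume :=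
  ((integrableOn_split₁ hT hC hm).add (integrableOn_split₂ hT hC)).congr_fun
    (fun _ hx => (landenRight_split hT hx).symm) (isOpen_openUnitCube (d := m + 2)).measurableSet

end Landen

end HoffmanDepthOne

/-! ## Hoffman's relation in depth one -/

open HoffmanDepthOne in
/-- **Hoffman's relation in depth one inside the Kontsevich–Zagier calculus** (Euler's depth-two sum
formula `ζ(k+1) = Σ_{j<k-1} ζ(k−j, j+1)`, `k ≥ 3`), from the cubical-chart and interior-Landen
hypotheses: the order polytope `P` of the chain-plus-one poset dissects into
`Σ_j [ζ(k−j, j+1)] + [ζ(k,1)]` (rule 1a, `stub_hoffmanDepthOnePolytope`), and through the forest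
chart (rule 2, `stub_hoffmanDepthOneForest`), `E′`, one partial
fraction (rule 1b) and two cubical charts (rule 2) it is `≡ [ζ(k,1)] + [ζ(k+1)]`; subtract.
[cite: Hoffman1992, Theorem 5.1] -/
theorem stub_hoffmanDepthOne : CubicalChart → InteriorLanden → HoffmanDepthOneInKZ := by
  intro hC hL k hk
  obtain ⟨m, rfl⟩ : ∃ m, k = m + 1 := ⟨k - 1, by omega⟩
  have hm : 1 ≤ m := by omega
  show zIdx [m + 2] 1 - ∑ j ∈ Finset.range m, zIdx [m + 1 - j, j + 1] 1 ∈ KZ.relations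
  obtain ⟨T, hT⟩ : ∃ T : ℕ → (Fin (m + 2) → ℝ) → ℝ,
      ∀ k x, T k x = ∏ j : Fin (m + 2), if (j : ℕ) < k then x j else 1 := ⟨_, fun _ _ => rfl⟩
  -- (P) + (D): the order polytope and its dissection
  obtain ⟨P, hPd, hPi, hA⟩ := stub_hoffmanDepthOnePolytope m hm
  -- (F): the forest chart
  obtain ⟨⟨L, hLd, hLi⟩, hLeq⟩ := stub_hoffmanDepthOneForest m P hPd hPi
  have hB : KZ.of L - KZ.of P ∈ KZ.relations := hLeq L hLd (by rw [hLi]; exact fun _ _ => rfl)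
  -- the three cube representations of the right Landen side
  have hε₁ : Adm (bword (m + 2) [m + 1, 1]) := adm_bword (isAdmissible_chain_one hm) rfl
  have hε₂ : Adm (bword (m + 2) [m + 2]) := adm_bword (isAdmissible_top m) rfl
  let R : KZ.IntegralRep (m + 2) := ⟨cube (m + 2),
    fun x => 1 / ((1 - T (m + 1) x) * (1 - T (m + 2) x)), isSemialgebraic_cube _,
    isSemialgebraicFunOn_landenRight hT, integrableOn_landenRight hT hC hm⟩
  let R₁ : KZ.IntegralRep (m + 2) := ⟨cube (m + 2),
    fun x => T (m + 1) x / ((1 - T (m + 1) x) * (1 - T (m + 2) x)), isSemialgebraic_cube _,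
    isSemialgebraicFunOn_split₁ hT, integrableOn_split₁ hT hC hm⟩
  let R₂ : KZ.IntegralRep (m + 2) := ⟨cube (m + 2), fun x => 1 / (1 - T (m + 2) x),
    isSemialgebraic_cube _, isSemialgebraicFunOn_split₂ hT, integrableOn_split₂ hT hC⟩
  -- (E′): the interior Landen identity
  have hCL : KZ.of L - KZ.of R ∈ KZ.relations :=
    hL m hm L R hLd (by rw [hLi]; exact fun _ _ => rfl) rfl fun x _ => landenRight_eq hT x
  -- (PF): the partial fraction
  have hD : KZ.of R - KZ.of R₁ - KZ.of R₂ ∈ KZ.relations :=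
    KZ.integrandAddRel_subset_relations ⟨m + 2, R, R₁, R₂, rfl, rfl,
      fun x hx => landenRight_split hT hx, rfl⟩
  -- (CC): the two cubical charts
  have hE₁ : KZ.of (wordRep _ 1 hε₁) - KZ.of R₁ ∈ KZ.relations :=
    (hC (m + 2) _ hε₁ 1).2 R₁ rfl fun x hx => (cubicalFun_chain_one hT hx).symm
  have hE₂ : KZ.of (wordRep _ 1 hε₂) - KZ.of R₂ ∈ KZ.relations :=
    (hC (m + 2) _ hε₂ 1).2 R₂ rfl fun x hx => (cubicalFun_top hT hx).symm
  -- assembly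
  rw [zIdx_eq (N := m + 2) rfl hε₁ 1] at hA
  rw [zIdx_eq (N := m + 2) rfl hε₂ 1]
  have : KZ.of (wordRep (bword (m + 2) [m + 2]) 1 hε₂) -
      ∑ j ∈ Finset.range m, zIdx [m + 1 - j, j + 1] 1 =
      (KZ.of P - (∑ j ∈ Finset.range m, zIdx [m + 1 - j, j + 1] 1 +
        KZ.of (wordRep (bword (m + 2) [m + 1, 1]) 1 hε₁))) +
      (KZ.of L - KZ.of P) - (KZ.of L - KZ.of R) - (KZ.of R - KZ.of R₁ - KZ.of R₂) +
      (KZ.of (wordRep (bword (m + 2) [m + 1, 1]) 1 hε₁) - KZ.of R₁) +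
      (KZ.of (wordRep (bword (m + 2) [m + 2]) 1 hε₂) - KZ.of R₂) := by abel
  rw [this]
  exact add_mem (add_mem (sub_mem (sub_mem (add_mem hA hB) hCL) hD) hE₁) hE₂


open HoffmanDepthOne in
/-- **The weight-4 rung: `ζ(4) = ζ(3,1) + ζ(2,2)` inside the calculus.** The `k = 3` instance of
`stub_hoffmanDepthOne` is the refuters' element `Negative.cHoffman4 = [ω₀₀₀₁] − [ω₀₀₁₁] − [ω₀₁₀₁]`
(which, with `Negative.cFds4`, closes the weight-4 rung `Negative.weightKernel_four_iff`).
[cite: Hoffman1992, Theorem 5.1] -/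
theorem cHoffman4_mem_relations_of (hC : CubicalChart) (hL : InteriorLanden) : Summit.KontsevichZagierPeriods.MzvKernelInKZ.Negative.cHoffman4 ∈ KZ.relations := by
  have h := stub_hoffmanDepthOne hC hL 3 le_rfl
  have e4 : zIdx [4] 1 = KZ.of (wordRep ω4 1 adm_ω4) := by
    rw [zIdx_eq (N := 4) rfl (adm_bword (s := [4]) (by decide) rfl) 1]
    congr 1
  have e31 : zIdx [3, 1] 1 = KZ.of (wordRep ω31 1 adm_ω31) := by
    rw [zIdx_eq (N := 4) rfl (adm_bword (s := [3, 1]) (by decide) rfl) 1]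
    congr 1
  have e22 : zIdx [2, 2] 1 = KZ.of (wordRep ω22 1 adm_ω22) := by
    rw [zIdx_eq (N := 4) rfl (adm_bword (s := [2, 2]) (by decide) rfl) 1]
    congr 1
  have hs : ∑ j ∈ Finset.range (3 - 1), zIdx [3 - j, j + 1] 1 = zIdx [3, 1] 1 + zIdx [2, 2] 1 := by
    rw [show (3 : ℕ) - 1 = 2 from rfl, Finset.sum_range_succ, Finset.sum_range_one]
  rw [hs, show (3 : ℕ) + 1 = 4 from rfl, e4, e31, e22, ← sub_sub] at h
  exact h

end Summit.KontsevichZagierPeriods.MzvKernelInKZ.TwoPosets
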